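import Summits.CriticalPhenomena.PercolationContinuityZ3.Theorems.PercNearOneGluingNoHeavyLowerTailCSHDefs
import HarnessLib

/-!
# The MIXED conditioned slack hierarchy (hub observer) — DEFINITIONS

Definitions file (`--supports stmt-CriticalPhenomena-4575`), prover `prim-ineq-gen-7` (gen 8).  Memo
`prim-ineq-gen-7/PROOF-Q9-MIXED-CSH.md` §2 and §4 (Theorems M1, M2); roadmap §9.2.  No named facts, no sorries.

PURPOSE.  Kozma–Nitzan's Question 9 (arXiv:2401.12397 §5.5; ⟹ Conjecture 6 without hypothesis, tree socket
`shorteningStep_of_question9`) designates the minimiser of `P_H(a ↔ b)` in the relay graph `H = G − E(o)` while the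
inequality (41) lives in `G`.  Integrating the open star of the observer `o` turns `o` into a HUB glued to a vertex set `Σ`
of `H`; every quantity of the cell's conditioned slack hierarchy ([W] = `prim-hp-8/CSH-WRITEUP.md`, tree `CSH.*`) that
mentions the first observer `o` gets a hub analogue, all conditioning staying in `H`:
* test   `1{o ∈ C_x}` (given `x ↮ Y`)      ↦  `hubEv Σ x Y = {Σ ∩ C_x ≠ ∅} ∩ {Σ ↮ Y}`   ("the hub is in `C^G_x` and not joined to `Y`");
* decoy constant `c_j(o) = μ(o ∈ C_{d_j} | d_j ↮ Y_j)`  ↦  `μ(hubEv Σ d_j Y_j | d_j ↮ Y_j)`  (`mixAvoidConst`, `mixDecoyList`);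
* observers' constant `p = μ(o ∈ C_v | v ↮ Y_{k+1})`   ↦  `μ(hubEv Σ v Y_{k+1} | v ↮ Y_{k+1})`  (`mixObsConst`);
* the `o`-entry of the conditional covariance `covD`     ↦  `mixCovD` (test `hubEv Σ x Y` instead of `{x ↔ o}`).
The level forms `CSH.slForm` / `CSH.cshMarg` are reused unchanged: the hub is addressed by a LABEL vertex `o : V` (in the application:
the observer of `G`, isolated in `H`), and all functions `V → ℝ` fed to the forms carry the hub quantity at `o` and the pure `H`-quantity
elsewhere.  `MixCSHHolds w Σ x Y D o v` is the mixed statement MIX-CSH(Y; x; D; Σ, v) of the memo (Theorem M1: it holds for all data at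
non-degenerate weights); `mixPreF` is the functional of the mixed pre-FKG peeling (Theorem M2).  For `Σ = {o}` with `o` a genuine vertex
all definitions reduce to the pure ones on `{x ↮ Y}` (the extra condition `Σ ↮ Y` is automatic there).
[cite: KozmaNitzan2024, Question 9 (§5.5 p. 36), Conj. 6 (§5.3 p. 34), Conj. 4 (p. 32)] [cite: VandenbergHaggstromKahn2005, Thm. 2.1 (p. 9), Thm. 1.3 (p. 6)]
-/

noncomputable section

namespace Summit.CriticalPhenomena.PercolationContinuityZ3.Theorems

open MeasureTheory Set Literature.Probability.LatticeModels Literature.Probability.Percolation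
open scoped Classical

namespace MixCSH

variable {V : Type*}

/-- **The hub test.**  `hubEv Σ x A = {Σ ∩ C_x ≠ ∅} ∩ {Σ ↮ A}`: some vertex of the hub set `Σ` lies in the open cluster of `x`, and no
vertex of `Σ` is joined to the avoided set `A` — in the observer's graph `G = H + (o glued to Σ)`: `o ∈ C^G_x` and `x ↮_G A`, given `x ↮_H A`.
(transcription of the cell memo prim-ineq-gen-7 PROOF-Q9-MIXED-CSH.md §2) [folklore] -/
def hubEv (Sig : Set V) (x : V) (A : Set V) : Set (BondConfig V) :=
  {ω | (∃ σ ∈ Sig, (openGraph ω).Reachable x σ) ∧ ∀ σ ∈ Sig, ∀ a ∈ A, ¬ (openGraph ω).Reachable a σ}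

/-- Membership in the hub test. [folklore] -/
theorem mem_hubEv (Sig : Set V) (x : V) (A : Set V) (ω : BondConfig V) :
    ω ∈ hubEv Sig x A ↔ (∃ σ ∈ Sig, (openGraph ω).Reachable x σ) ∧ ∀ σ ∈ Sig, ∀ a ∈ A, ¬ (openGraph ω).Reachable a σ :=
  Iff.rfl

/-- **The mixed decoy constant** (memo §2): at the hub label `o` it is `μ(d ↮ A, hubEv Σ d A) / μ(d ↮ A)`, at a vertex `u` of the relay
graph it is the pure `CSH.avoidConst w d A u = μ(d ↮ A, d ↔ u)/μ(d ↮ A)`. (transcription of the cell memo prim-ineq-gen-7 PROOF-Q9-MIXED-CSH.md §2) [folklore] -/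
def mixAvoidConst (w : Sym2 V → unitInterval) (Sig : Set V) (o d : V) (A : Set V) : V → ℝ := fun u =>
  if u = o then
    (prodBernoulli w).real ({ω : BondConfig V | ∀ a ∈ A, ¬ (openGraph ω).Reachable d a} ∩ hubEv Sig d A) /
      (prodBernoulli w).real {ω : BondConfig V | ∀ a ∈ A, ¬ (openGraph ω).Reachable d a}
  else CSH.avoidConst w d A u

/-- **The mixed decoy/constant list**: decoys `d_1, …, d_k` in order, the `j`-th constant conditioned on `d_j ↮ A ∪ {d_1..d_{j-1}}`, with
the hub entry at the label `o`. (transcription of the cell memo prim-ineq-gen-7 PROOF-Q9-MIXED-CSH.md §2) [folklore] -/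
def mixDecoyList (w : Sym2 V → unitInterval) (Sig : Set V) (o : V) : Set V → List V → List (V × (V → ℝ))
  | _, [] => []
  | A, d :: ds => (d, mixAvoidConst w Sig o d A) :: mixDecoyList w Sig o (insert d A) ds

/-- **The mixed observers' constant** `p = μ(v ↮ A, hubEv Σ v A) / μ(v ↮ A)` ("the hub lies in `C_v` and is not joined to `A`, given
`v ↮ A`"). (transcription of the cell memo prim-ineq-gen-7 PROOF-Q9-MIXED-CSH.md §2) [folklore] -/
def mixObsConst (w : Sym2 V → unitInterval) (Sig : Set V) (v : V) (A : Set V) : ℝ :=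
  (prodBernoulli w).real ({ω : BondConfig V | ∀ a ∈ A, ¬ (openGraph ω).Reachable v a} ∩ hubEv Sig v A) /
    (prodBernoulli w).real {ω : BondConfig V | ∀ a ∈ A, ¬ (openGraph ω).Reachable v a}

/-- **The mixed denominator-free conditional covariance**: at the hub label `o`,
`μ(D)·∫_{D ∩ hubEv Σ x Y} f(C_x) − (∫_D f(C_x))·μ(D ∩ hubEv Σ x Y)` (`D = {x ↮ Y}`); elsewhere the pure `CSH.covD`.
(transcription of the cell memo prim-ineq-gen-7 PROOF-Q9-MIXED-CSH.md §2) [folklore] -/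
def mixCovD (w : Sym2 V → unitInterval) (Sig : Set V) (o x : V) (Y : Set V) (f : Set (Sym2 V) → ℝ) : V → ℝ := fun u =>
  if u = o then
    (prodBernoulli w).real {ω : BondConfig V | ∀ y ∈ Y, ¬ (openGraph ω).Reachable x y} *
        (∫ ω in {ω : BondConfig V | ∀ y ∈ Y, ¬ (openGraph ω).Reachable x y} ∩ hubEv Sig x Y,
          f (openEdgeCluster ω x) ∂(prodBernoulli w)) -
      (∫ ω in {ω : BondConfig V | ∀ y ∈ Y, ¬ (openGraph ω).Reachable x y}, f (openEdgeCluster ω x) ∂(prodBernoulli w)) *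
        (prodBernoulli w).real ({ω : BondConfig V | ∀ y ∈ Y, ¬ (openGraph ω).Reachable x y} ∩ hubEv Sig x Y)
  else CSH.covD w x Y f u

/-- **The margin of MIX-CSH(Y; x; d_1..d_k; Σ, v)[f]** (memo §2): the level form `CSH.cshMarg` of the mixed decoy list and the mixed
observers' constant, applied to the mixed conditional covariances, hub label `o`.
(transcription of the cell memo prim-ineq-gen-7 PROOF-Q9-MIXED-CSH.md §2) [folklore] -/
def mixCshMargin (w : Sym2 V → unitInterval) (Sig : Set V) (x : V) (Y : Set V) (D : List V) (o v : V)
    (f : Set (Sym2 V) → ℝ) : ℝ :=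
  CSH.cshMarg (mixDecoyList w Sig o (insert x Y) D) (mixObsConst w Sig v (insert x Y ∪ {d | d ∈ D})) o v (mixCovD w Sig o x Y f)

/-- **The mixed conditioned slack hierarchy statement MIX-CSH(Y; x; D; Σ, v)**: the margin is nonnegative for every monotone functional of the
open edge cluster of the owner (memo Theorem M1 asserts it for all data with distinct named vertices, `o` a label outside them, at non-degenerate
weights). (transcription of the cell memo prim-ineq-gen-7 PROOF-Q9-MIXED-CSH.md §2) [folklore] -/
def MixCSHHolds (w : Sym2 V → unitInterval) (Sig : Set V) (x : V) (Y : Set V) (D : List V) (o v : V) : Prop :=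
  ∀ f : Set (Sym2 V) → ℝ, Monotone f → 0 ≤ mixCshMargin w Sig x Y D o v f

/-- **The glued cluster seen from the hub**: the union of the open (vertex) clusters of the vertices of `Σ` — the vertex set of `C^G_o ∖ {o}`.
(transcription of the cell memo prim-ineq-gen-7 PROOF-Q9-MIXED-CSH.md §0 R1) [folklore] -/
def hubCluster (Sig : Set V) (ω : BondConfig V) : Set V := ⋃ σ ∈ Sig, openCluster ω σ

/-- **The functional of the mixed pre-FKG peeling (Theorem M2)**: for a relay set `X` and designated relay `c`, at a vertex `u` of the relay graph
`Δ^H_u(X) = ∫_{u ↔ X} (F(C_u) − F(C_c))`, and at the hub label `o` the hub form of `Δ^G_o(X)`: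
`∫_{Σ ↔ X} (F(C_Σ) − F(C^Σ_c))`, `C_Σ = hubCluster`, `C^Σ_c = C_c ∪ C_Σ` if `c ↔ Σ` else `C_c`.
(transcription of the cell memo prim-ineq-gen-7 PROOF-Q9-MIXED-CSH.md §4) [folklore] -/
def mixPreF (w : Sym2 V → unitInterval) (Sig : Set V) (o : V) (X : Finset V) (c : V) (F : Set V → ℝ) : V → ℝ := fun u =>
  if u = o then
    ∫ ω in {ω : BondConfig V | ∃ σ ∈ Sig, ∃ a ∈ X, (openGraph ω).Reachable a σ},
      (F (hubCluster Sig ω) -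
        F (if ∃ σ ∈ Sig, (openGraph ω).Reachable c σ then openCluster ω c ∪ hubCluster Sig ω else openCluster ω c))
      ∂(prodBernoulli w)
  else ∫ ω in ⋃ a ∈ X, openConn u a, (F (openCluster ω u) - F (openCluster ω c)) ∂(prodBernoulli w)

/-- **The margin of the mixed pre-FKG peeling statement (Theorem M2)**: the level form of the relay set `X` (mixed constants conditioned on
avoiding `X` and the earlier decoys) applied to `mixPreF`. (transcription of the cell memo prim-ineq-gen-7 PROOF-Q9-MIXED-CSH.md §4) [folklore] -/
def mixPreMargin (w : Sym2 V → unitInterval) (Sig : Set V) (X : Finset V) (c : V) (D : List V) (o v : V) (F : Set V → ℝ) : ℝ :=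
  CSH.cshMarg (mixDecoyList w Sig o ↑X D) (mixObsConst w Sig v (↑X ∪ {d | d ∈ D})) o v (mixPreF w Sig o X c F)

/-! ### Elementary unfoldings -/

/-- With no decoys the mixed margin is `f̃(o) − p · covD(v)`. [folklore] -/
theorem mixCshMargin_nil (w : Sym2 V → unitInterval) (Sig : Set V) (x : V) (Y : Set V) (o v : V) (f : Set (Sym2 V) → ℝ) :
    mixCshMargin w Sig x Y [] o v f =
      mixCovD w Sig o x Y f o - mixObsConst w Sig v (insert x Y) * mixCovD w Sig o x Y f v := by
  simp only [mixCshMargin, mixDecoyList, CSH.cshMarg_nil, List.not_mem_nil, setOf_false, union_empty]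

/-- With no decoys the mixed pre-FKG margin is `Δ^G_o(X) − p · Δ^H_v(X)`. [folklore] -/
theorem mixPreMargin_nil (w : Sym2 V → unitInterval) (Sig : Set V) (X : Finset V) (c o v : V) (F : Set V → ℝ) :
    mixPreMargin w Sig X c [] o v F =
      mixPreF w Sig o X c F o - mixObsConst w Sig v ↑X * mixPreF w Sig o X c F v := by
  simp only [mixPreMargin, mixDecoyList, CSH.cshMarg_nil, List.not_mem_nil, setOf_false, union_empty]

/-- The hub entry of `mixCovD`. [folklore] -/
theorem mixCovD_hub (w : Sym2 V → unitInterval) (Sig : Set V) (o x : V) (Y : Set V) (f : Set (Sym2 V) → ℝ) :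
    mixCovD w Sig o x Y f o =
      (prodBernoulli w).real {ω : BondConfig V | ∀ y ∈ Y, ¬ (openGraph ω).Reachable x y} *
          (∫ ω in {ω : BondConfig V | ∀ y ∈ Y, ¬ (openGraph ω).Reachable x y} ∩ hubEv Sig x Y,
            f (openEdgeCluster ω x) ∂(prodBernoulli w)) -
        (∫ ω in {ω : BondConfig V | ∀ y ∈ Y, ¬ (openGraph ω).Reachable x y}, f (openEdgeCluster ω x) ∂(prodBernoulli w)) *
          (prodBernoulli w).real ({ω : BondConfig V | ∀ y ∈ Y, ¬ (openGraph ω).Reachable x y} ∩ hubEv Sig x Y) := by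
  simp [mixCovD]

/-- The relay-graph entries of `mixCovD` are the pure ones. [folklore] -/
theorem mixCovD_of_ne (w : Sym2 V → unitInterval) (Sig : Set V) {o u : V} (hu : u ≠ o) (x : V) (Y : Set V)
    (f : Set (Sym2 V) → ℝ) : mixCovD w Sig o x Y f u = CSH.covD w x Y f u := by
  simp [mixCovD, hu]

/-- The hub entry of `mixAvoidConst`. [folklore] -/
theorem mixAvoidConst_hub (w : Sym2 V → unitInterval) (Sig : Set V) (o d : V) (A : Set V) :
    mixAvoidConst w Sig o d A o =
      (prodBernoulli w).real ({ω : BondConfig V | ∀ a ∈ A, ¬ (openGraph ω).Reachable d a} ∩ hubEv Sig d A) /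
        (prodBernoulli w).real {ω : BondConfig V | ∀ a ∈ A, ¬ (openGraph ω).Reachable d a} := by
  simp [mixAvoidConst]

/-- The relay-graph entries of `mixAvoidConst` are the pure ones. [folklore] -/
theorem mixAvoidConst_of_ne (w : Sym2 V → unitInterval) (Sig : Set V) {o u : V} (hu : u ≠ o) (d : V) (A : Set V) :
    mixAvoidConst w Sig o d A u = CSH.avoidConst w d A u := by
  simp [mixAvoidConst, hu]

/-- The hub entry of `mixPreF` (the hub form of `Δ^G_o(X)`). [folklore] -/
theorem mixPreF_hub (w : Sym2 V → unitInterval) (Sig : Set V) (o : V) (X : Finset V) (c : V) (F : Set V → ℝ) :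
    mixPreF w Sig o X c F o =
      ∫ ω in {ω : BondConfig V | ∃ σ ∈ Sig, ∃ a ∈ X, (openGraph ω).Reachable a σ},
        (F (hubCluster Sig ω) -
          F (if ∃ σ ∈ Sig, (openGraph ω).Reachable c σ then openCluster ω c ∪ hubCluster Sig ω else openCluster ω c))
        ∂(prodBernoulli w) := by
  simp [mixPreF]

/-- The relay-graph entries of `mixPreF` (the pure pre-FKG surplus `Δ^H_u(X)`). [folklore] -/
theorem mixPreF_of_ne (w : Sym2 V → unitInterval) (Sig : Set V) {o u : V} (hu : u ≠ o) (X : Finset V) (c : V) (F : Set V → ℝ) :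
    mixPreF w Sig o X c F u = ∫ ω in ⋃ a ∈ X, openConn u a, (F (openCluster ω u) - F (openCluster ω c)) ∂(prodBernoulli w) := by
  simp [mixPreF, hu]

/-- The decoys of `mixDecoyList w Σ o A D` are the members of `D` (same shape as `CSH.decoyList`). [folklore] -/
theorem map_fst_mixDecoyList (w : Sym2 V → unitInterval) (Sig : Set V) (o : V) :
    ∀ (A : Set V) (D : List V), (mixDecoyList w Sig o A D).map Prod.fst = D
  | _, [] => rfl
  | A, d :: D => by simp only [mixDecoyList, List.map_cons, map_fst_mixDecoyList w Sig o (insert d A) D]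

end MixCSH

end Summit.CriticalPhenomena.PercolationContinuityZ3.Theorems
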